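import Literature.MathematicalPhysics.QuantumFieldTheory.Balaban1983to89.Node00.Record12Numerics
import Literature.MathematicalPhysics.QuantumFieldTheory.Balaban1983to89.B9LeafKnitNonVacuity

/-!
# NODE 00 — NON-ABELIAN WITNESSES OF RECORD for the staged non-vacuity statements (director-ym №268 (4), SECOND RING of the record-abelian repair
# FLAG №14, mode (b) «zero rebuild» of the plan's sizing word): every `∃ θ ∕ ∃ w` satisfiability theorem of NODE 00 whose historical proof keyed the
# coefficient algebra to the scalar placeholder `𝔸 := ℂ` is RE-WITNESSED HERE AT THE DICTIONARY OF RECORD `Node00.stage3OfRecord₁₂` (carrier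
# `M₂(ℂ) = Matrix (Fin 2) (Fin 2) ℂ`, C⋆-structure `B10Eq29TubeLine.cstarAlgebraMatrix 2`), with the carrier clause `θ.𝔸 = stage3OfRecord₁₂.𝔸` IN the statement.

Cell `pub-ymgap`, YM-PLAN Track A (HUMAN RULING D-0062); desk `pub-ymgap-node00-def-RR-2` (definition lane, gen 20); lane key K0⁷ `stmt-QuantumFields-20541`
(`--supports`, never closed here).  Sources: [Balaban1984PropagatorsII] = Comm. Math. Phys. 96, 223–250 (Stage-3 dictionary (2.1)–(2.4) p.224, (2.16) p.225);
[Balaban1985Averaging] = Comm. Math. Phys. 98, 17–51 (coefficient algebra `M_N(ℂ)`, pp.18–19); [Balaban1985BackgroundPropagators] = Comm. Math. Phys. 99,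
389–434 (Thms 3.1–3.15); [Balaban1987RG1] = Comm. Math. Phys. 109, 249–301 (p.253, `L` odd).

WHY.  The seven discharges' INHABITED-AT-k clauses cite NODE 00's satisfiability theorems; eight of those theorems (nine literal sites) were proved with the
witness literal `{ θ with 𝔸 := ℂ, … }` — a carrier-BLIND construction (no statement among them exposes `𝔸`), but an ABELIAN instance on the page
(director-ym №256 (1)(c)).  Since the FLAG №14 edition of `Node00/Record12Numerics` the dictionary of record `stage3OfRecord₁₂` carries `𝔸 := M₂(ℂ)`, is
admissible (`admissible_stage3OfRecord₁₂`) and has `D = 4` (`stage3OfRecord₁₂_D`).  Re-keying the eight deep files in place would rebuild 4.6–7.8 k modules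
each (plan's sizing, mode (a)); this leaf instead states each theorem ONCE MORE with the witness EXPOSED and KEYED BY NAME to the record — the stronger form
`∃ θ …, θ.𝔸 = stage3OfRecord₁₂.𝔸 ∧ ‹the original conjuncts verbatim›` (worlds hidden behind `IsWorldOfRecord₂∕₃ w` get their parameter `θ` and the
construction clause `∀ P, ∃ X Y Z V W, w.up P = Upstream.ofPrintedAllXPN (carriersₛ θ X) Y Z V W` exposed) — so it survives any later re-key of the carrier.
The historical `ℂ`-literal proofs stay where they are as proofs of `𝔸`-free statements; the four LIGHT files (`B14NodeKnitFrame`, `B9LeafUnpinnedRecord5`,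
`Node00/N02Dossier`, `B10LeafUnpinnedRecord5C`) are re-keyed in place by editions.

WHAT IS TYPED (theorems only; every witness is `stage3OfRecord₁₂`, its Stage-2 part, or the local `{ stage3OfRecord₁₂ with L := … }` where the original fixes
another block size; no definition is introduced).  §1 `exists_stage3Params_admissible_nonAbelian` — re-witnesses `Node00.N24_exists_stage3Params` (`Node00/N24Glue`), `B16NodeKnit.exists_stage3Params_admissible`,
`B10NodeKnit.exists_stage3Params_admissible` (one statement covering the three historical sites; the last one omits `D = 4`); `exists_isWorldOfRecord₂_nonAbelian` —
`Node00.exists_isWorldOfRecord₂` (`Node00/Satisfiable`).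
§2 `N03_worldOfRecord₃_exists_dim4_oddL_nonAbelian`, `N03_worldOfRecord₃_exists_dim4_L5_nonAbelian` — the N03 dossier ∕ odd-`L` witnesses (block size
`ℓ + 1`, resp. `5`, written into the record; admissibility does not read `L`).  §3 `exists_isWorldOfRecord₂_not_b9_main_nonAbelian`,
`exists_isWorldOfRecord₃_b6_main_imp_not_b9_main_nonAbelian` — the two `B9LeafUnpinned` census worlds, rebuilt over the record.  §4
`exists_isWorldOfRecord₂_knitHypotheses_nonAbelian` — the `B9LeafKnitNonVacuity` knit-hypotheses world: all its carrier-free conjuncts are TRANSPORTED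
from the landed theorem (they concern the bundles `X`, `Y` only) and the world is re-bound over `carriers₂ stage3OfRecord₁₂.toStage2Params X`.

HONEST FRAMING.  Bookkeeping over definitions: existence witnesses for typed predicates of ONE finite-volume `𝕋⁴` programme at fixed `ε`, Bałaban's
papers AS PRINTED; no estimate is proved, no key ∕ record inhabitant of the discharge keys is claimed (K0⁷ `Record13SepCoPHInhabited` stays OPEN), nothing
here is continuum ∕ `ℝ⁴` ∕ Osterwalder–Schrader ∕ mass gap ∕ Clay.  COUNT-NEUTRAL (8 ∕ 28 discharged nodes unchanged).  Zero reverse-dependants by design.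
-/

namespace Literature.MathematicalPhysics.QuantumFieldTheory.Balaban1983to89.Node00

open DagBinding DagDischargedII

/-! ## §1  Stage-3 parameters and Stage-2 worlds of record AT THE RECORD -/

/-- **Admissible Stage-3 parameters with `D = 4` EXIST AT THE RECORD CARRIER** — witnessed by the dictionary of record `stage3OfRecord₁₂` itself
(`𝔸 = M₂(ℂ)`, `D = 4`, `L = 3`, `d₆ = 3`, `ℓ₆ = 2`, band `b₀ = b₁ = 1`, rate `δ₀ = 2∕3`).  Non-abelian re-witnessing of `Node00.N24_exists_stage3Params`
(`Node00/N24Glue`), `B16NodeKnit.exists_stage3Params_admissible` and `B10NodeKnit.exists_stage3Params_admissible` (historical `𝔸 := ℂ` literals; the same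
`𝔸`-free statement at the first two sites, the third without the conjunct `D = 4` — all three follow from this one). [cite: Balaban1984PropagatorsII, (2.1)–(2.4) p.224, (2.16) p.225; Balaban1985Averaging, pp.18–19 (coefficient algebra `M_N(ℂ)`) — bookkeeping witness] -/
theorem exists_stage3Params_admissible_nonAbelian :
    ∃ θ : Stage3Params, θ.𝔸 = stage3OfRecord₁₂.𝔸 ∧ θ.toStage1Params.Admissible ∧ θ.D = 4 :=
  ⟨stage3OfRecord₁₂, rfl, admissible_stage3OfRecord₁₂, stage3OfRecord₁₂_D⟩

/-- **`IsWorldOfRecord₂` is satisfiable AT THE RECORD CARRIER**: the constant N-binding over `carriers₂ stage3OfRecord₁₂.toStage2Params X` (un-pinned bundles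
degenerate, as in `Node00.Satisfiable`), with the Stage-2 parameter and the binding clause EXPOSED.  Non-abelian re-witnessing of `Node00.exists_isWorldOfRecord₂` of `Node00/Satisfiable`
(historical literal `{ θ with 𝔸 := ℂ }`, print's `N = 1`; here `N = 2`). [cite: Balaban1985Averaging, Props. 1–10 pp.26–50, pp.18–19 (`M_N(ℂ)`) — bookkeeping witness] -/
theorem exists_isWorldOfRecord₂_nonAbelian :
    ∃ (θ : Stage2Params) (w : WorldP), θ.𝔸 = stage3OfRecord₁₂.𝔸 ∧ θ.toStage1Params.Admissible ∧
      (∀ P : B12.RunParams, ∃ (X : PrintedCarriersR) (Y : PrintedCarriers9X) (Z : PrintedCarriers11) (V : PrintedCarriers14R) (W : PrintedCarriers15),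
        w.up P = Upstream.ofPrintedAllXPN (carriers₂ θ X) Y Z V W) ∧ IsWorldOfRecord₂ w := by
  obtain ⟨X⟩ := nonempty_printedCarriersR
  obtain ⟨Y⟩ := nonempty_printedCarriers9X
  obtain ⟨Z⟩ := nonempty_printedCarriers11
  obtain ⟨V⟩ := nonempty_printedCarriers14R
  obtain ⟨W⟩ := nonempty_printedCarriers15
  obtain ⟨w⟩ := nonempty_worldP
  exact ⟨stage3OfRecord₁₂.toStage2Params, WorldP.withUp w fun _ => Upstream.ofPrintedAllXPN (carriers₂ stage3OfRecord₁₂.toStage2Params X) Y Z V W,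
    rfl, admissible_stage3OfRecord₁₂, fun _ => ⟨X, Y, Z, V, W, rfl⟩,
    isWorldOfRecord₂_of_up _ admissible_stage3OfRecord₁₂ X Y Z V W _ rfl⟩

/-! ## §2  The N03 Stage-3 worlds of record (block size `ℓ + 1`, resp. `5`) AT THE RECORD CARRIER -/

/-- **Stage-3 worlds of record with `D = 4` and EVERY odd `L = ℓ + 1 ≥ 3` EXIST AT THE RECORD CARRIER** — parameter := the dictionary of record with its block
size reset to `ℓ + 1` (`ℓ₆ := ℓ`, Lemma-2.1 rate `δ₀ := 2∕(ℓ + 1)`; every other letter, in particular the carrier `𝔸 = M₂(ℂ)`, as in `stage3OfRecord₁₂`;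
admissibility does not read `L`), world := the constant N-binding over `carriers₃ θ X` (un-pinned bundles degenerate).  Non-abelian re-witnessing of `Node00.N03_worldOfRecord₃_exists_dim4_oddL` of
`Node00/N03IndexOddL` (historical literal `𝔸 := ℂ`). [cite: Balaban1984PropagatorsII, (2.1)–(2.4) p.224, (2.16) p.225 (Stage-3 parameter dictionary) — bookkeeping witness] -/
theorem N03_worldOfRecord₃_exists_dim4_oddL_nonAbelian (ℓ : ℕ) (hL : Odd (ℓ + 1) ∧ 1 < ℓ + 1) :
    ∃ (θ : Stage3Params) (w : WorldP), θ.𝔸 = stage3OfRecord₁₂.𝔸 ∧ θ.toStage1Params.Admissible ∧ θ.D = 4 ∧ θ.L = ℓ + 1 ∧ θ.ℓ₆ = ℓ ∧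
      IsWorldOfRecord₃ w ∧
      ∀ P : B12.RunParams, ∃ (X : PrintedCarriersR) (Y : PrintedCarriers9X) (Z : PrintedCarriers11) (V : PrintedCarriers14R) (W : PrintedCarriers15),
        w.up P = Upstream.ofPrintedAllXPN (carriers₃ θ X) Y Z V W := by
  obtain ⟨X⟩ := nonempty_printedCarriersR
  obtain ⟨Y⟩ := nonempty_printedCarriers9X
  obtain ⟨Z⟩ := nonempty_printedCarriers11
  obtain ⟨V⟩ := nonempty_printedCarriers14R
  obtain ⟨W⟩ := nonempty_printedCarriers15
  obtain ⟨w⟩ := nonempty_worldP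
  let θ₃ : Stage3Params :=
    { stage3OfRecord₁₂ with
      L := ℓ + 1, hL := hL, ℓ₆ := ℓ, hℓ₆ := rfl, δ₀ := 2 / ((ℓ : ℝ) + 1), hδ₀ := ⟨by positivity, le_rfl⟩ }
  have hθ₃ : θ₃.toStage1Params.Admissible := admissible_stage3OfRecord₁₂
  exact ⟨θ₃, WorldP.withUp w fun _ => Upstream.ofPrintedAllXPN (carriers₃ θ₃ X) Y Z V W, rfl, hθ₃, rfl, rfl, rfl,
    isWorldOfRecord₃_of_up θ₃ hθ₃ X Y Z V W _ rfl, fun _ => ⟨X, Y, Z, V, W, rfl⟩⟩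

/-- **Stage-3 worlds of record with `D = 4`, `L = 5` EXIST AT THE RECORD CARRIER** (the case `ℓ = 4` of the previous theorem).  Non-abelian re-witnessing of
`Node00.N03_worldOfRecord₃_exists_dim4_L5` of `Node00/N03Dossier` (historical literal `𝔸 := ℂ`). [cite: Balaban1984PropagatorsII, (2.1)–(2.4) p.224, (2.16) p.225 (Stage-3 parameter dictionary) — bookkeeping witness] -/
theorem N03_worldOfRecord₃_exists_dim4_L5_nonAbelian :
    ∃ (θ : Stage3Params) (w : WorldP), θ.𝔸 = stage3OfRecord₁₂.𝔸 ∧ θ.toStage1Params.Admissible ∧ θ.D = 4 ∧ θ.L = 5 ∧ θ.ℓ₆ = 4 ∧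
      IsWorldOfRecord₃ w ∧
      ∀ P : B12.RunParams, ∃ (X : PrintedCarriersR) (Y : PrintedCarriers9X) (Z : PrintedCarriers11) (V : PrintedCarriers14R) (W : PrintedCarriers15),
        w.up P = Upstream.ofPrintedAllXPN (carriers₃ θ X) Y Z V W :=
  N03_worldOfRecord₃_exists_dim4_oddL_nonAbelian 4 ⟨⟨2, by norm_num⟩, by norm_num⟩

/-! ## §3  The two `B9LeafUnpinned` census worlds AT THE RECORD CARRIER -/

/-- **A Stage-2 world of record AT THE RECORD CARRIER at which N06 FAILS for every run** — parameter `stage3OfRecord₁₂.toStage2Params`; the run's free [B6]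
block := the lineage's one-level knit block (`withB6OfRecord X D L 1 1 0`, so `b6` HOLDS by `b6_withB6OfRecord`), `b4` ∕ `b5` ∕ `b7` hold at Stage 2
(`carriers₁_b4 ∕ _b5`, `carriers₂_b7`), the free B9 bundle := the witness of `B9LeafUnpinned.exists_not_b9LeafX`.  Non-abelian re-witnessing of
`B9LeafUnpinned.exists_isWorldOfRecord₂_not_b9_main` (historical literal `{ θ with 𝔸 := ℂ }`), parameter and binding clause EXPOSED.
[cite: Balaban1985BackgroundPropagators, Thms 3.1–3.15 pp.397–432; Balaban1985Averaging, Props. 1–10 pp.26–50 (bookkeeping over the staged predicates)] -/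
theorem exists_isWorldOfRecord₂_not_b9_main_nonAbelian :
    ∃ (θ : Stage2Params) (w : WorldP), θ.𝔸 = stage3OfRecord₁₂.𝔸 ∧ θ.toStage1Params.Admissible ∧
      (∀ P : B12.RunParams, ∃ (X : PrintedCarriersR) (Y : PrintedCarriers9X) (Z : PrintedCarriers11) (V : PrintedCarriers14R) (W : PrintedCarriers15),
        w.up P = Upstream.ofPrintedAllXPN (carriers₂ θ X) Y Z V W) ∧
      IsWorldOfRecord₂ w ∧ ∀ P : B12.RunParams, ¬ Dag.B9_main (leavesP w P) := by
  obtain ⟨X⟩ := nonempty_printedCarriersR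
  obtain ⟨Y, -, hY⟩ := B9LeafUnpinned.exists_not_b9LeafX
  obtain ⟨Z⟩ := nonempty_printedCarriers11
  obtain ⟨V⟩ := nonempty_printedCarriers14R
  obtain ⟨W⟩ := nonempty_printedCarriers15
  obtain ⟨w⟩ := nonempty_worldP
  have hθ : stage3OfRecord₁₂.toStage1Params.Admissible := admissible_stage3OfRecord₁₂
  let θ₂ : Stage2Params := stage3OfRecord₁₂.toStage2Params
  let X' : PrintedCarriersR := withB6OfRecord X stage3OfRecord₁₂.D stage3OfRecord₁₂.L 1 1 0
  refine ⟨θ₂, WorldP.withUp w fun _ => Upstream.ofPrintedAllXPN (carriers₂ θ₂ X') Y Z V W, rfl, hθ, fun _ => ⟨X', Y, Z, V, W, rfl⟩,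
    isWorldOfRecord₂_of_up θ₂ hθ X' Y Z V W _ rfl, fun P hmain => hY ?_⟩
  have hb6 : (Upstream.ofPrintedAllXPN (carriers₂ θ₂ X') Y Z V W).b6 :=
    b6_withB6OfRecord X Y Z V W hθ.1 stage3OfRecord₁₂.hL one_pos one_pos le_rfl
  exact hmain (carriers₁_b4 _ hθ _ Y Z V W) (carriers₁_b5 _ hθ _ Y Z V W) hb6 (carriers₂_b7 θ₂ X' Y Z V W)

/-- **A Stage-3 world of record AT THE RECORD CARRIER at which N03 implies ¬ N06 for every run** — parameter `stage3OfRecord₁₂` itself (the [B6] block pinned to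
the tower block of record `D6OfRecord`), the free B9 bundle := the witness of `B9LeafUnpinned.exists_not_b9LeafX`; `b4` ∕ `b5` ∕ `b7` hold, so `Dag.B6_main`
makes N06's antecedents all true while its leaf fails.  Non-abelian re-witnessing of `B9LeafUnpinned.exists_isWorldOfRecord₃_b6_main_imp_not_b9_main`
(historical literal `𝔸 := ℂ`, `d₆ := 3`, `ℓ₆ := L − 1`), parameter and binding clause EXPOSED.
[cite: Balaban1985BackgroundPropagators, Thms 3.1–3.15 pp.397–432; Balaban1984PropagatorsII, pp.223–250 (bookkeeping over the staged predicates)] -/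
theorem exists_isWorldOfRecord₃_b6_main_imp_not_b9_main_nonAbelian :
    ∃ (θ : Stage3Params) (w : WorldP), θ.𝔸 = stage3OfRecord₁₂.𝔸 ∧ θ.toStage1Params.Admissible ∧
      (∀ P : B12.RunParams, ∃ (X : PrintedCarriersR) (Y : PrintedCarriers9X) (Z : PrintedCarriers11) (V : PrintedCarriers14R) (W : PrintedCarriers15),
        w.up P = Upstream.ofPrintedAllXPN (carriers₃ θ X) Y Z V W) ∧
      IsWorldOfRecord₃ w ∧ ∀ P : B12.RunParams, Dag.B6_main (leavesP w P) → ¬ Dag.B9_main (leavesP w P) := by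
  obtain ⟨X⟩ := nonempty_printedCarriersR
  obtain ⟨Y, -, hY⟩ := B9LeafUnpinned.exists_not_b9LeafX
  obtain ⟨Z⟩ := nonempty_printedCarriers11
  obtain ⟨V⟩ := nonempty_printedCarriers14R
  obtain ⟨W⟩ := nonempty_printedCarriers15
  obtain ⟨w⟩ := nonempty_worldP
  have hθ : stage3OfRecord₁₂.toStage1Params.Admissible := admissible_stage3OfRecord₁₂
  refine ⟨stage3OfRecord₁₂, WorldP.withUp w fun _ => Upstream.ofPrintedAllXPN (carriers₃ stage3OfRecord₁₂ X) Y Z V W, rfl, hθ,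
    fun _ => ⟨X, Y, Z, V, W, rfl⟩, isWorldOfRecord₃_of_up _ hθ X Y Z V W _ rfl, fun P h6main hmain => hY ?_⟩
  have hb4 : (Upstream.ofPrintedAllXPN (carriers₃ stage3OfRecord₁₂ X) Y Z V W).b4 := carriers₁_b4 _ hθ _ Y Z V W
  have hb5 : (Upstream.ofPrintedAllXPN (carriers₃ stage3OfRecord₁₂ X) Y Z V W).b5 := carriers₁_b5 _ hθ _ Y Z V W
  have hb7 : (Upstream.ofPrintedAllXPN (carriers₃ stage3OfRecord₁₂ X) Y Z V W).b7 :=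
    carriers₂_b7 stage3OfRecord₁₂.toStage2Params (withB6KOfRecord X stage3OfRecord₁₂) Y Z V W
  exact hmain hb4 hb5 (h6main hb4 hb5) hb7

/-! ## §4  The knit-hypotheses world of `B9LeafKnitNonVacuity` AT THE RECORD CARRIER (transport) -/

/-- **Stage-2 parameters AT THE RECORD CARRIER, bundles, a world of record and a `U = 1` dictionary meeting EVERY hypothesis of the knit** — the statement of
`B9LeafKnitNonVacuity.exists_isWorldOfRecord₂_knitHypotheses` VERBATIM with the carrier clause `θ.𝔸 = stage3OfRecord₁₂.𝔸` prepended.  Proof by TRANSPORT: the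
landed theorem's bundles `X`, `Y`, index map and dictionary and its carrier-free conjuncts (all of them but the first three concern `X` and `Y` only) are kept;
the parameter becomes `stage3OfRecord₁₂.toStage2Params` and the world is re-bound over `carriers₂ stage3OfRecord₁₂.toStage2Params X` (historical literal
`{ θ with 𝔸 := ℂ }`). [cite: Balaban1985BackgroundPropagators, Thms 3.1–3.15 pp.397–432; Balaban1984PropagatorsII, Lemma 2.1–Cor. 2.8 pp.234–249; Balaban1985Averaging, pp.18–19 (bookkeeping witness)] -/
theorem exists_isWorldOfRecord₂_knitHypotheses_nonAbelian :
    ∃ (θ : Node00.Stage2Params) (X : PrintedCarriersR) (Y : PrintedCarriers9X) (Z : PrintedCarriers11) (V : PrintedCarriers14R)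
      (W : PrintedCarriers15) (w : WorldP) (ι : Y.I9 → X.D6.I)
      (_Dict : ∀ i : Y.I9, B9FromB6.DictAtOne (X.D6.geo (ι i)) (Y.geo9 i) (Y.bg9 i) (X.D6.Gp (ι i)) (X.D6.Cinv (ι i)) (X.D6.G (ι i))
        (Y.Gp i) (Y.GA i) (Y.Cinv i)),
      θ.𝔸 = stage3OfRecord₁₂.𝔸 ∧ θ.toStage1Params.Admissible ∧ Node00.IsWorldOfRecord₂ w ∧
      (∀ P : B12.RunParams, w.up P = Upstream.ofPrintedAllXPN (Node00.carriers₂ θ X) Y Z V W) ∧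
      Nonempty Y.I9 ∧ (∀ m : ℝ, ∃ i : Y.I9, m ≤ (Y.geo9 i).M) ∧
      (∀ (i : Y.I9) (n : Fin 4) (U : (Y.bg9 i).Cfg) (lam : (Y.geo9 i).Loc) (y : (Y.geo9 i).Site), (Y.Gp i).e n U lam y = 0) ∧
      B6BlockParam X.D6 ∧ X.D6.d = Y.d9 ∧ (∀ i : Y.I9, B9FromB6.ModelSigns (Y.geo9 i)) ∧
      B9FromB6.ResidualGpAtOne Y.geo9 Y.bg9 Y.Gp ∧ B9FromB6.ResidualGAGlobAtOne Y.geo9 Y.bg9 Y.GA ∧ 0 < Y.c35 ∧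
      (∀ i : Y.I9, ∀ α₀ : ℝ, 0 < α₀ → (Y.bg9 i).Reg335 Y.c35 α₀ (Y.bg9 i).one) ∧
      B9.SectBStepPrinted Y.d9 Y.c35 Y.geo9 Y.bg9 Y.Gp Y.GA Y.Cinv Y.IsAnalyticExt ∧
      B9.GaugeReduction335 Y.d9 Y.c35 Y.geo9 Y.bg9 Y.InCube Y.Gp Y.GA Y.Cinv ∧
      B9.Thm37Printed Y.c35 Y.geo9 Y.bg9 Y.E37 ∧ B9.Cor38Printed Y.c35 Y.geo9 Y.bg9 Y.E37 ∧
      B9.Thm39Printed Y.d9 Y.c35 Y.geo9 Y.bg9 Y.EK39 ∧ B9.Thm310Printed Y.c35 Y.geo9 Y.bg9 Y.E310 ∧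
      B9.RWSumsYieldIneqs Y.geo9 Y.bg9 Y.E37 Y.E310 Y.Gp Y.GA ∧ B9.RWKernelSumYields Y.d9 Y.geo9 Y.bg9 Y.EK39 Y.Cinv ∧
      B9.Thm311Printed Y.c35 Y.geo9 Y.bg9 Y.PosDef ∧
      B9.Thm312Printed Y.d9 Y.c35 Y.geo9 Y.bg9 Y.GD Y.G₁ Y.H Y.H₁ Y.HasRWExp Y.HasRWExpH Y.PosDefK ∧
      B9.Thm313Printed Y.c35 Y.geo9 Y.bg9 Y.GG Y.HasRWExp Y.PosDefK ∧
      B9.Thm314Printed Y.c35 Y.geo9 Y.bg9 Y.Kdiff Y.dOmega ∧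
      B9.Thm315FullPrinted Y.c35 Y.geo9 Y.bg9 Y.Ck Y.inΛ Y.unitDist Y.GivenBy3185 Y.HasRWExpC ∧
      B9.Stmt349Printed Y.d9 Y.c35 Y.geo9 Y.bg9 Y.P349 ∧
      B9.Stmt3132Printed Y.d9 Y.c35 Y.geo9 Y.bg9 Y.QGQinv Y.QG1Qinv ∧
      B9Thm314.Thm314LocalPrinted Y.c35 Y.geo9 Y.bg9 Y.Kdiff Y.OmK Y.dOmega := by
  obtain ⟨-, X, Y, Z, V, W, w, ι, Dict, -, -, -, hrest⟩ := B9LeafKnitNonVacuity.exists_isWorldOfRecord₂_knitHypotheses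
  have hθ : stage3OfRecord₁₂.toStage1Params.Admissible := admissible_stage3OfRecord₁₂
  exact ⟨stage3OfRecord₁₂.toStage2Params, X, Y, Z, V, W,
    WorldP.withUp w fun _ => Upstream.ofPrintedAllXPN (Node00.carriers₂ stage3OfRecord₁₂.toStage2Params X) Y Z V W, ι, Dict, rfl, hθ,
    isWorldOfRecord₂_of_up _ hθ X Y Z V W _ rfl, fun _ => rfl, hrest⟩

end Literature.MathematicalPhysics.QuantumFieldTheory.Balaban1983to89.Node00
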